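import Summits.RiemannHypothesis.RiemannHypothesis.Theses.GroundBarta
import HarnessLib

/-!
# Route GroundBarta — the assembly item (stmt-RiemannHypothesis-18392)

The assembly `GroundBartaFloor → PolarPerronFrobenius → EvenWinsBeyondArch → OddNegativityOffLine →
RiemannHypothesis` is literally the route's kernel-checked deciding theorem `closes` (by
contradiction: the rung's floor `-e(a) ≤ Re Q(h)`, `e → 0`, at a window beyond every height carrying
a one-signed ground state, against the uniform odd negativity `Re Q(h) ≤ -η` an off-line zero
forces).  No new mathematics; this file only discharges the ledger item by the one-line transport.
-/

-- D-0017: single-problem summit ⇒ namespace `Summit.RiemannHypothesis.RiemannHypothesis.…` by design.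
set_option linter.dupNamespace false

namespace Summit.RiemannHypothesis.RiemannHypothesis.Theorems.GroundBarta

/-- **Assembly of route GroundBarta** (item stmt-RiemannHypothesis-18392): the four items imply the
Riemann Hypothesis — the route's deciding theorem `GroundBarta.closes`, re-packaged as the
implication `Assembly`. -/
theorem assembly_proof : Summit.RiemannHypothesis.RiemannHypothesis.Theses.GroundBarta.Assembly :=
  fun hFloor hPF hEven hNeg =>
    Summit.RiemannHypothesis.RiemannHypothesis.Theses.GroundBarta.closes hFloor hPF hEven hNeg

end Summit.RiemannHypothesis.RiemannHypothesis.Theorems.GroundBarta
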